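import Literature.NumberTheory.EllipticCurves.LocalKernelOfReductionGaloisTransportProofs
import Literature.NumberTheory.EllipticCurves.ZpExtensionEisensteinTwistResidualTau
import Literature.NumberTheory.GaloisCohomology.Howard2004.TransportStrictProofs
import HarnessLib

/-!
# H.5(b) at a place `v ∣ p` for the residual STRICT ordinary condition of `E[p]`: `θ_v ∘ transport_v` carries
# `ker (H¹(K_{σv}, E[p]) → H¹(K_{σv}, E[p]/Fil_{σv}))` onto `ker (H¹(K_v, E[p]) → H¹(K_v, E[p]/Fil_v))` (theorems only)

`Proofs` file (theorems only; no definition, no named fact, no instance, no `sorry`).  Topic `NumberTheory/EllipticCurves`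
(D1 road of cell `pub/bsd-print-x9`; brick (A′) of `bsd-line-x10b-p1-w8` g2's (H5B-P): Howard's hypothesis **H.5(b)**
[B. Howard, Compositio Math. 140 (2004), §1.3, arXiv:1202.6340 p. 7 L96–97: «the condition `F` propagated to `T̄` is stable
under the action of `G_ℚ`»] for the Eisenstein specialisation of `E_K` at the places `v ∣ p` of good ORDINARY reduction,
memo `HOME/x9-p1-w3/H5B-AT-S-PLAN-w3g5.md` §3).

In the NON-ANOMALOUS case the residual image at `v ∣ p` of Howard's ordinary condition `F_𝔮` on `T̄_𝔮 = E[p]` is the STRICT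
condition of the ordinary line `Fil_v E[p] = E[p] ∩ E₁(K̄_v)` (`WeierstrassCurve.torsionFilAt`; Howard §3.1
«`Fil_v T` = the kernel of reduction»): `ker (H¹(K_v, E[p]) → H¹(K_v, E[p] / Fil_v E[p])) = im H¹(K_v, Fil_v E[p])`
(generic: `Tower.map_levelCondition_one_eq_ker` of `TowerSaturatedKernelCoresProofs`).  The `v`-clause of H.5(b) for such
residual conditions is then the statement of this file:

* **`WeierstrassCurve.map_thetaH1_comp_transportH1_strictSubgroup_torsionFilAt_eq`** — for the CANONICAL conjugation
  datum `ConjugationDatum.ofLifts σ … τ …` and the `G_ℚ`-structure `θ = τ_*` on `E[p]` (`residualTauGeomTorsion`):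
  `(θ_v ∘ transport_v) (strict_{σ v}(Fil_{σ v} E[p])) = strict_v(Fil_v E[p])`.  Ingredients: the generic transport
  `Howard2004.map_thetaH1_comp_transportH1_strictSubgroup_eq` (x10b-p1-w8, `TransportStrictProofs`); «`τ` carries
  `Fil_{σ v}` to `Fil_v`» in the form `τ_* (δ_v · Fil_{σv} E[n]) ⊆ Fil_v E[n]` (x10b-p1-w5,
  `torsionMap_delta_apply_mem_torsionFilAt`); and ONTO by counting — the same lemma at the place `σ v` gives an injection
  `Fil_v ↪ Fil_{σ v}`, so the injection `Fil_{σ v} ↪ Fil_v, x ↦ τ_*(δ_v x)` of finite sets is a bijection (no cyclicity or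
  order computation needed).

No summit statement is proved; BSD is not proved by any of this.

References: [Howard2004HeegnerKolyvagin] §1.3 H.5(a)/(b), §3.1 (arXiv:1202.6340 p. 7 L33–48 and L93–97, p. 15 L56–66);
[SilvermanAEC2009] VII.2 Props. 2.1–2.2 (`E₁`), Cor. III.6.4 (`E[n]` finite); [SerreGaloisCohomology1997] I §2.4.
-/

set_option autoImplicit false

noncomputable section

open Function NumberField IsDedekindDomain Field
open scoped NumberField

namespace WeierstrassCurve

open Literature.NumberTheory.EllipticCurves Literature.NumberTheory.GaloisRepresentations
open Literature.NumberTheory.GaloisRepresentations.DiscreteGaloisModule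
open Literature.NumberTheory.GaloisCohomology.Howard2004
open Literature.NumberTheory.EllipticCurves.IwasawaAlgebra

variable {K : Type} [Field K] [NumberField K] (W : WeierstrassCurve ℚ) [W.IsElliptic] {p : ℕ} [hp : Fact p.Prime]
  (σ : K ≃ₐ[ℚ] K) (hσ₁ : σ ≠ 1) (hσ : σ * σ = 1) (τ : AlgebraicClosure K ≃+* AlgebraicClosure K)
  (hτ : IsLiftOfAut σ τ) (hτ₂ : Function.Involutive τ)

omit [W.IsElliptic] hp in
/-- `Fil_v E[n]` is stable under the decomposition group, in the `≤ comap` form consumed by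
`DiscreteGaloisModule.strictSubgroup`. [cite: Howard2004HeegnerKolyvagin, §3.1 (arXiv:1202.6340 p. 15, L56–58: Fil_v is G_{K_v}-stable)] -/
theorem torsionFilAt_le_comap_toLocal (v : HeightOneSpectrum (𝓞 K)) (n : ℤ)
    (g : absoluteGaloisGroup (v.adicCompletion K)) :
    (W.baseChange K).torsionFilAt v n ≤
      ((W.baseChange K).torsionFilAt v n).comap (GaloisRep.toLocal v ((W.baseChange K).torsionGaloisModule n) g) := by
  intro P hP
  exact (W.baseChange K).smul_mem_torsionFilAt v n g P hP

/-- **`x ↦ τ_*(δ_v x)` maps `Fil_{σ v} E[n]` ONTO `Fil_v E[n]`** for the canonical conjugation datum `ofLifts` (`E` elliptic,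
`n ≠ 0`): into by x10b-p1-w5's `torsionMap_delta_apply_mem_torsionFilAt`, onto because the same lemma at the place `σ v`
(`σ σ v = v`) injects `Fil_v` into `Fil_{σ v}` and both are finite — an injection between finite sets of the same size is a
bijection. [cite: Howard2004HeegnerKolyvagin, §1.3 and §3.1 (arXiv:1202.6340 p. 7 L33–48, p. 15 L56–58: v̄ = v^τ, Fil_v)]
[cite: SilvermanAEC2009, Cor. III.6.4 and VII.2 Props. 2.1–2.2] -/
theorem exists_torsionMap_delta_apply_eq_of_mem_torsionFilAt (v : HeightOneSpectrum (𝓞 K)) {n : ℤ} (hn : n ≠ 0)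
    {y : geomTorsion (W.baseChange K) n} (hy : y ∈ (W.baseChange K).torsionFilAt v n) :
    ∃ x ∈ (W.baseChange K).torsionFilAt (σ • v) n,
      hτ.torsionMap W n ((W.baseChange K).torsionGaloisModule n ((ConjugationDatum.ofLifts σ hσ₁ hσ τ hτ hτ₂).δ v) x) = y := by
  haveI : CharZero ((σ • v).adicCompletion K) := charZero_of_injective_algebraMap (algebraMap K _).injective
  haveI : CharZero (v.adicCompletion K) := charZero_of_injective_algebraMap (algebraMap K _).injective
  haveI : CharZero ((σ • (σ • v)).adicCompletion K) := charZero_of_injective_algebraMap (algebraMap K _).injective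
  haveI : Finite (geomTorsion (W.baseChange K) n) := finite_torsionPoints_holds (W.baseChange K) (AlgebraicClosure K) hn
  set cd := ConjugationDatum.ofLifts σ hσ₁ hσ τ hτ hτ₂ with hcd
  have hvv : σ • (σ • v) = v := by rw [smul_smul, hσ, one_smul]
  -- the map `x ↦ τ_*(δ_w x)` is injective on `E[n]`, at every place `w`
  have hinj : ∀ w : HeightOneSpectrum (𝓞 K), Function.Injective fun x : geomTorsion (W.baseChange K) n ↦
      hτ.torsionMap W n ((W.baseChange K).torsionGaloisModule n (cd.δ w) x) := by
    intro w x x' hxx'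
    have h1 : (W.baseChange K).torsionGaloisModule n (cd.δ w) x = (W.baseChange K).torsionGaloisModule n (cd.δ w) x' := by
      have h2 := congrArg (hτ.torsionMap W n) hxx'
      have hinv : ∀ P, hτ.torsionMap W n (hτ.torsionMap W n P) = P := fun P ↦ by
        apply Subtype.ext
        rw [IsLiftOfAut.coe_torsionMap, IsLiftOfAut.coe_torsionMap]
        generalize (P : geomPoints (W.baseChange K)) = Q
        change ((W.baseChange K).baseChange (AlgebraicClosure K)).toAffine.Point at Q
        rcases Q with _ | ⟨a, b, h⟩
        · rfl
        · exact Affine.Point.some_eq_some_of_eq (hτ₂ a) (hτ₂ b)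
      simpa only [hinv] using h2
    have h3 := congrArg ((W.baseChange K).torsionGaloisModule n (cd.δ w)⁻¹) h1
    change ((W.baseChange K).torsionGaloisModule n).toRepresentation (cd.δ w)⁻¹
        (((W.baseChange K).torsionGaloisModule n).toRepresentation (cd.δ w) x) =
      ((W.baseChange K).torsionGaloisModule n).toRepresentation (cd.δ w)⁻¹
        (((W.baseChange K).torsionGaloisModule n).toRepresentation (cd.δ w) x') at h3
    rwa [← Module.End.mul_apply, ← map_mul, inv_mul_cancel, map_one, Module.End.one_apply,
      ← Module.End.mul_apply, ← map_mul, inv_mul_cancel, map_one, Module.End.one_apply] at h3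
  -- the restricted maps `Fil_{σv} → Fil_v` and `Fil_v → Fil_{σv}`
  let φ : (W.baseChange K).torsionFilAt (σ • v) n → (W.baseChange K).torsionFilAt v n := fun x ↦
    ⟨hτ.torsionMap W n ((W.baseChange K).torsionGaloisModule n (cd.δ v) x.1),
      W.torsionMap_delta_apply_mem_torsionFilAt σ hσ₁ hσ τ hτ hτ₂ v n x.2⟩
  let ψ : (W.baseChange K).torsionFilAt v n → (W.baseChange K).torsionFilAt (σ • v) n := fun y ↦
    ⟨hτ.torsionMap W n ((W.baseChange K).torsionGaloisModule n (cd.δ (σ • v)) y.1),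
      W.torsionMap_delta_apply_mem_torsionFilAt σ hσ₁ hσ τ hτ hτ₂ (σ • v) n (a' := y.1) (by rw [hvv]; exact y.2)⟩
  have hφ : Function.Injective φ := fun x x' h ↦ Subtype.ext (hinj v (congrArg Subtype.val h))
  have hψ : Function.Injective ψ := fun y y' h ↦ Subtype.ext (hinj (σ • v) (congrArg Subtype.val h))
  have hcard : Nat.card ((W.baseChange K).torsionFilAt v n) ≤ Nat.card ((W.baseChange K).torsionFilAt (σ • v) n) :=
    Nat.card_le_card_of_injective ψ hψ
  obtain ⟨x, hx⟩ := (hφ.bijective_of_nat_card_le hcard).2 ⟨y, hy⟩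
  exact ⟨x.1, x.2, congrArg Subtype.val hx⟩

/-- **H.5(b) at `v ∣ p` for the residual strict ordinary condition of `E[p]`.**  For the canonical conjugation datum
`cd = ofLifts σ … τ …` and Howard's `G_ℚ`-structure `θ = τ_*` on `T̄ = E[p]` (`residualTauGeomTorsion`, an `A_{m,k}`-linear
involution through the residue character):
`(θ_v ∘ transport_v) (ker (H¹(K_{σv}, E[p]) → H¹(K_{σv}, E[p]/Fil_{σv} E[p]))) = ker (H¹(K_v, E[p]) → H¹(K_v, E[p]/Fil_v E[p]))`
— «`τ` takes the local condition at `v̄ = v^τ` isomorphically to the local condition at `v`» for the strict conditions of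
the ordinary lines `Fil_v E[p] = E[p] ∩ E₁(K̄_v)`. [cite: Howard2004HeegnerKolyvagin, §1.3 H.5(b) and §3.1 (arXiv:1202.6340 p. 7 L93–97, p. 15 L56–66)]
[cite: SerreGaloisCohomology1997, Ch. I §2.4 (compatible pairs)] -/
theorem map_thetaH1_comp_transportH1_strictSubgroup_torsionFilAt_eq {m k : ℕ} (hm : 1 ≤ m) (hk : 1 ≤ k)
    (v : HeightOneSpectrum (𝓞 K)) :
    letI := EisensteinCoeff.residueModule (p := p) (m := m) (k := k) hm hk
      ((W.baseChange K).prime_nsmul_geomTorsion_eq_zero (p := p))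
    (DiscreteGaloisModule.strictSubgroup (GaloisRep.toLocal (σ • v) ((W.baseChange K).torsionGaloisModule (p : ℤ)))
        ((W.baseChange K).torsionFilAt (σ • v) (p : ℤ))
        (W.torsionFilAt_le_comap_toLocal (σ • v) (p : ℤ))).map
      (((W.residualTauGeomTorsion (p := p) (ConjugationDatum.ofLifts σ hσ₁ hσ τ hτ hτ₂) hm hk).thetaH1 (Sum.inr v)).comp
        ((ConjugationDatum.ofLifts σ hσ₁ hσ τ hτ hτ₂).transportH1 ((W.baseChange K).torsionGaloisModule (p : ℤ)) v)) =
    DiscreteGaloisModule.strictSubgroup (GaloisRep.toLocal v ((W.baseChange K).torsionGaloisModule (p : ℤ)))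
        ((W.baseChange K).torsionFilAt v (p : ℤ))
        (W.torsionFilAt_le_comap_toLocal v (p : ℤ)) := by
  letI := EisensteinCoeff.residueModule (p := p) (m := m) (k := k) hm hk
    ((W.baseChange K).prime_nsmul_geomTorsion_eq_zero (p := p))
  haveI : CharZero ((σ • v).adicCompletion K) := charZero_of_injective_algebraMap (algebraMap K _).injective
  haveI : CharZero (v.adicCompletion K) := charZero_of_injective_algebraMap (algebraMap K _).injective
  have hpz : (p : ℤ) ≠ 0 := by exact_mod_cast hp.out.ne_zero
  refine map_thetaH1_comp_transportH1_strictSubgroup_eq (R := EisensteinCoeff p m k)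
    (ConjugationDatum.ofLifts σ hσ₁ hσ τ hτ hτ₂) ((W.baseChange K).torsionGaloisModule (p : ℤ))
    (W.residualTauGeomTorsion (p := p) (ConjugationDatum.ofLifts σ hσ₁ hσ τ hτ hτ₂) hm hk) v
    ((W.baseChange K).torsionFilAt (σ • v) (p : ℤ)) ((W.baseChange K).torsionFilAt v (p : ℤ))
    (W.torsionFilAt_le_comap_toLocal (σ • v) (p : ℤ)) (W.torsionFilAt_le_comap_toLocal v (p : ℤ))
    (fun x hx ↦ ?_) (fun y hy ↦ ?_)
  · rw [W.residualTauGeomTorsion_θ_apply (p := p) _ hm hk]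
    exact W.torsionMap_delta_apply_mem_torsionFilAt σ hσ₁ hσ τ hτ hτ₂ v (p : ℤ) hx
  · obtain ⟨x, hx, hxy⟩ := W.exists_torsionMap_delta_apply_eq_of_mem_torsionFilAt σ hσ₁ hσ τ hτ hτ₂ v hpz hy
    refine ⟨x, hx, ?_⟩
    rw [W.residualTauGeomTorsion_θ_apply (p := p) _ hm hk]
    exact hxy

end WeierstrassCurve

end
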